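import Summits.Ventures.PercRepro.SixFourResidueFourPlaneLineTWDefs

/-!
# PercRepro — C-025 at `(6,4)`: the TW-100 table at `t = 4`, `83 ≤ g ≤ 92` (p3, gen 11 — §21.18.7)

The per-`g` checks `minCheckAll g` (the minimiser `m*(g,q)` of `L(g,q,m)/C(m,2)` is a minimiser, integer form) and
`twCheckAll g` (the cell inequality `w′(g,n,e,s) ≥ 0` of Lemma TW with `μ = L(m*)/C(m*,2)`, integer form) for `83 ≤ g ≤ 92`,
by `decide +kernel`; see `SixFourResidueFourPlaneLineTWDefs.lean` for the definitions and the transfer lemmas.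
-/

namespace PercRepro.SixFour

set_option maxRecDepth 20000

/-- `minCheckAll 83` (by `decide +kernel`). -/
theorem minCheckAll_83 : minCheckAll 83 := by unfold minCheckAll; decide +kernel
/-- `twCheckAll 83` (by `decide +kernel`). -/
theorem twCheckAll_83 : twCheckAll 83 := by unfold twCheckAll; decide +kernel

/-- `minCheckAll 84` (by `decide +kernel`). -/
theorem minCheckAll_84 : minCheckAll 84 := by unfold minCheckAll; decide +kernel
/-- `twCheckAll 84` (by `decide +kernel`). -/
theorem twCheckAll_84 : twCheckAll 84 := by unfold twCheckAll; decide +kernel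

/-- `minCheckAll 85` (by `decide +kernel`). -/
theorem minCheckAll_85 : minCheckAll 85 := by unfold minCheckAll; decide +kernel
/-- `twCheckAll 85` (by `decide +kernel`). -/
theorem twCheckAll_85 : twCheckAll 85 := by unfold twCheckAll; decide +kernel

/-- `minCheckAll 86` (by `decide +kernel`). -/
theorem minCheckAll_86 : minCheckAll 86 := by unfold minCheckAll; decide +kernel
/-- `twCheckAll 86` (by `decide +kernel`). -/
theorem twCheckAll_86 : twCheckAll 86 := by unfold twCheckAll; decide +kernel

/-- `minCheckAll 87` (by `decide +kernel`). -/
theorem minCheckAll_87 : minCheckAll 87 := by unfold minCheckAll; decide +kernel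
/-- `twCheckAll 87` (by `decide +kernel`). -/
theorem twCheckAll_87 : twCheckAll 87 := by unfold twCheckAll; decide +kernel

/-- `minCheckAll 88` (by `decide +kernel`). -/
theorem minCheckAll_88 : minCheckAll 88 := by unfold minCheckAll; decide +kernel
/-- `twCheckAll 88` (by `decide +kernel`). -/
theorem twCheckAll_88 : twCheckAll 88 := by unfold twCheckAll; decide +kernel

/-- `minCheckAll 89` (by `decide +kernel`). -/
theorem minCheckAll_89 : minCheckAll 89 := by unfold minCheckAll; decide +kernel
/-- `twCheckAll 89` (by `decide +kernel`). -/
theorem twCheckAll_89 : twCheckAll 89 := by unfold twCheckAll; decide +kernel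

/-- `minCheckAll 90` (by `decide +kernel`). -/
theorem minCheckAll_90 : minCheckAll 90 := by unfold minCheckAll; decide +kernel
/-- `twCheckAll 90` (by `decide +kernel`). -/
theorem twCheckAll_90 : twCheckAll 90 := by unfold twCheckAll; decide +kernel

/-- `minCheckAll 91` (by `decide +kernel`). -/
theorem minCheckAll_91 : minCheckAll 91 := by unfold minCheckAll; decide +kernel
/-- `twCheckAll 91` (by `decide +kernel`). -/
theorem twCheckAll_91 : twCheckAll 91 := by unfold twCheckAll; decide +kernel

/-- `minCheckAll 92` (by `decide +kernel`). -/
theorem minCheckAll_92 : minCheckAll 92 := by unfold minCheckAll; decide +kernel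
/-- `twCheckAll 92` (by `decide +kernel`). -/
theorem twCheckAll_92 : twCheckAll 92 := by unfold twCheckAll; decide +kernel

/-- `minCheckAll g` for every `83 ≤ g ≤ 92`. -/
theorem minCheckAll_of_rangeE {g : ℕ} (hg : 83 ≤ g) (hg' : g ≤ 92) : minCheckAll g := by
  interval_cases g
  exacts [minCheckAll_83, minCheckAll_84, minCheckAll_85, minCheckAll_86, minCheckAll_87, minCheckAll_88, minCheckAll_89, minCheckAll_90, minCheckAll_91, minCheckAll_92]

/-- `twCheckAll g` for every `83 ≤ g ≤ 92`. -/
theorem twCheckAll_of_rangeE {g : ℕ} (hg : 83 ≤ g) (hg' : g ≤ 92) : twCheckAll g := by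
  interval_cases g
  exacts [twCheckAll_83, twCheckAll_84, twCheckAll_85, twCheckAll_86, twCheckAll_87, twCheckAll_88, twCheckAll_89, twCheckAll_90, twCheckAll_91, twCheckAll_92]

end PercRepro.SixFour
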